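import Mathlib
import Summits.Ventures.HodgeRepro2.T5ComponentSum
import Summits.Ventures.HodgeRepro2.T5IdentityPrincipleGlobal

/-!
# T5ComponentIdentity — the identity principle on a connected component of the surface

Tier-5 support for sub-step N1 (Hodge-theoretic side; memo route/T5-N1-hodge-p6.md §H6 and §H8):
the global identity principle of `T5IdentityPrincipleGlobal` is stated for a CONNECTED charted
space; the memo applies it to a connected component `S_j` of the (possibly disconnected) compact
surface `S`.  This file makes that passage a kernel sentence:

* `locallyConnectedSpace_of_chartedSpace`: a charted space over a complex normed space is locally
  connected (so its components are open — `T5ComponentSum`);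
* `analyticOnNhd_chart_restrict`: «holomorphic in every chart of `S`» restricts to «holomorphic in
  every chart of an open subset» (Mathlib's charted-space structure on `Opens`, whose charts are the
  restrictions `subtypeRestr` of the charts of `S`);
* `eqOn_zero_component_of_eventually_zero`: a holomorphic `f` vanishing near one point of the
  component `S_j` vanishes on all of `S_j`;
* `exists_ne_zero_iff_subset_closure`: `f ≠ 0` somewhere on `S_j` ⟺ `{f ≠ 0} ∩ S_j` is dense in
  `S_j` (memo H6, (i) ⟺ (iv), on the component);
* `exists_component_subset_closure_of_ne_zero`: a holomorphic `f ≠ 0` on `S` is non-zero on a dense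
  subset of some component.

Blind lane (cell pub-hodge-repro2): `import Mathlib` + own files, 0 sorry, standard axioms.
-/

namespace Summit.Ventures.HodgeRepro2.T5ComponentIdentity

open Summit.Ventures.HodgeRepro2.T5ComponentSum Summit.Ventures.HodgeRepro2.T5IdentityPrincipleGlobal
open TopologicalSpace Set Filter Topology

variable {E : Type*} [NormedAddCommGroup E] [NormedSpace ℂ E]
variable {F : Type*} [NormedAddCommGroup F] [NormedSpace ℂ F]
variable {X : Type*} [TopologicalSpace X] [ChartedSpace E X]

omit [NormedSpace ℂ E] in
/-- A charted space modelled on a real normed space is locally connected (the model space is, by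
the convexity of balls — `T5IdentityPrincipleGlobal.locallyConnectedSpace_of_normedSpace_real`). -/
theorem locallyConnectedSpace_of_chartedSpace [NormedSpace ℝ E] : LocallyConnectedSpace X :=
  haveI : LocallyConnectedSpace E := locallyConnectedSpace_of_normedSpace_real
  ChartedSpace.locallyConnectedSpace E X

/-- «Holomorphic in every chart of `X`» restricts to every open subset `s`: the charts of `s` are the
restrictions of the charts of `X` (Mathlib `Opens.chartAt_eq`, `subtypeRestr_symm_apply`). -/
theorem analyticOnNhd_chart_restrict (s : Opens X) {f : X → F}
    (hf : ∀ x : X, AnalyticOnNhd ℂ (f ∘ (chartAt E x).symm) (chartAt E x).target) (x : s) :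
    AnalyticOnNhd ℂ ((f ∘ Subtype.val) ∘ (chartAt E x).symm) (chartAt E x).target := by
  rw [Opens.chartAt_eq]
  refine ((hf x.1).mono ((chartAt E x.1).subtypeRestr_target_subset ⟨x⟩)).congr
    ((chartAt E x.1).subtypeRestr ⟨x⟩).open_target fun y hy => ?_
  simp only [Function.comp_apply]
  exact congrArg f ((chartAt E x.1).subtypeRestr_symm_apply ⟨x⟩ hy).symm

section Component

variable [NormedSpace ℝ E]

/-- The connected component `c` of the charted space `X` as an open subset (open because `X` is
locally connected). -/
def componentOpens (c : ConnectedComponents X) : Opens X :=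
  haveI : LocallyConnectedSpace X := locallyConnectedSpace_of_chartedSpace (E := E)
  ⟨component c, isOpen_component c⟩

omit [NormedSpace ℂ E] in
/-- The underlying set of `componentOpens c` is `component c`. -/
theorem coe_componentOpens (c : ConnectedComponents X) :
    ((componentOpens (E := E) c : Opens X) : Set X) = component c := rfl

omit [NormedSpace ℂ E] in
/-- The component is a preconnected space (as a subtype). -/
theorem preconnectedSpace_componentOpens (c : ConnectedComponents X) :
    PreconnectedSpace (componentOpens (E := E) c) :=
  (connectedSpace_component c).toPreconnectedSpace

omit [NormedSpace ℂ E] in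
/-- The component is non-empty (as a subtype). -/
theorem nonempty_componentOpens (c : ConnectedComponents X) :
    Nonempty (componentOpens (E := E) c) :=
  (nonempty_component c).to_subtype

/-- Identity principle on a component: a function holomorphic in every chart of `X` that vanishes
on a neighbourhood of one point `x₀` of the component `S_j = component c` vanishes on all of
`S_j`. -/
theorem eqOn_zero_component_of_eventually_zero {f : X → F}
    (hf : ∀ x : X, AnalyticOnNhd ℂ (f ∘ (chartAt E x).symm) (chartAt E x).target)
    {c : ConnectedComponents X} {x₀ : X} (hx₀ : x₀ ∈ component c)
    (h : ∀ᶠ y in 𝓝 x₀, f y = 0) : ∀ x ∈ component c, f x = 0 := by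
  haveI := preconnectedSpace_componentOpens (E := E) c
  intro x hx
  have h' : ∀ᶠ y in 𝓝 (⟨x₀, hx₀⟩ : componentOpens (E := E) c), (f ∘ Subtype.val) y = 0 :=
    (continuous_subtype_val.continuousAt (x := (⟨x₀, hx₀⟩ : componentOpens (E := E) c))).eventually
      (p := fun y => f y = 0) h
  exact eq_zero_of_eventually_zero_complex (f := f ∘ Subtype.val)
    (analyticOnNhd_chart_restrict (componentOpens (E := E) c) hf) h' ⟨x, hx⟩

/-- Identity principle on a component, dense form (memo H6 (i) ⟺ (iv) on `S_j`): a function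
holomorphic in every chart of `X` is non-zero somewhere on the component `S_j` iff its non-vanishing
set meets `S_j` in a dense subset of `S_j`. -/
theorem exists_ne_zero_iff_subset_closure {f : X → F}
    (hf : ∀ x : X, AnalyticOnNhd ℂ (f ∘ (chartAt E x).symm) (chartAt E x).target)
    (c : ConnectedComponents X) :
    (∃ x ∈ component c, f x ≠ 0) ↔ component c ⊆ closure (component c ∩ {x | f x ≠ 0}) := by
  haveI := preconnectedSpace_componentOpens (E := E) c
  haveI := nonempty_componentOpens (E := E) c
  have key := exists_ne_zero_iff_dense_complex (f := f ∘ Subtype.val)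
    (analyticOnNhd_chart_restrict (componentOpens (E := E) c) hf)
  rw [Subtype.dense_iff] at key
  constructor
  · rintro ⟨x, hx, hfx⟩
    have hsub := key.mp ⟨⟨x, hx⟩, hfx⟩
    intro y hy
    refine closure_mono ?_ (hsub hy)
    rintro _ ⟨z, hz, rfl⟩
    exact ⟨z.2, hz⟩
  · intro hsub
    have hsub' : (componentOpens (E := E) c : Set X) ⊆
        closure (Subtype.val '' {x : componentOpens (E := E) c | (f ∘ Subtype.val) x ≠ 0}) := by
      intro y hy
      refine closure_mono ?_ (hsub hy)
      rintro z ⟨hz, hfz⟩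
      exact ⟨⟨z, hz⟩, hfz, rfl⟩
    obtain ⟨x, hfx⟩ := key.mpr hsub'
    exact ⟨x.1, x.2, hfx⟩

/-- A function holomorphic in every chart of `X` that is not identically zero is non-zero on a
dense subset of some component. -/
theorem exists_component_subset_closure_of_ne_zero {f : X → F}
    (hf : ∀ x : X, AnalyticOnNhd ℂ (f ∘ (chartAt E x).symm) (chartAt E x).target) (h : f ≠ 0) :
    ∃ c : ConnectedComponents X, component c ⊆ closure (component c ∩ {x | f x ≠ 0}) := by
  obtain ⟨c, x, hx, hfx⟩ := exists_component_exists_ne_zero h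
  exact ⟨c, (exists_ne_zero_iff_subset_closure (E := E) hf c).mp ⟨x, hx, hfx⟩⟩

/-- Conversely: if a holomorphic `f` vanishes on a non-empty open set `U`, it vanishes on every
component meeting `U` (the identity principle read as a vanishing statement). -/
theorem eqOn_zero_component_of_eqOn_zero_open {f : X → F}
    (hf : ∀ x : X, AnalyticOnNhd ℂ (f ∘ (chartAt E x).symm) (chartAt E x).target)
    {U : Set X} (hU : IsOpen U) (hfU : ∀ x ∈ U, f x = 0) {c : ConnectedComponents X}
    {x₀ : X} (hx₀ : x₀ ∈ component c) (hx₀U : x₀ ∈ U) : ∀ x ∈ component c, f x = 0 :=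
  eqOn_zero_component_of_eventually_zero (E := E) hf hx₀
    (Filter.eventually_of_mem (hU.mem_nhds hx₀U) fun y hy => hfU y hy)

end Component

end Summit.Ventures.HodgeRepro2.T5ComponentIdentity
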